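import Summits.SmoothPoincare4.SmoothPoincare4.Theorems.CongruenceShadowsHeegaardHandlebodyCongruenceClosedStubIsProductOfPrincipalLeftFamily

/-!
# Principal right-factor families are honest products — crux `CongruenceShadows.HeegaardHandlebodyCongruenceClosed`
(item stmt-SmoothPoincare4-14596), line `pair-rigidity-retraction`, registered helper stub
`stub_isProductOfPrincipalRightFamily` (the "right criterion", mirror of `stub_isProductOfPrincipalLeftFamily`)

Notation: `S = S_{3+3m} = SurfaceGroup (3+3m)`, `N = (N₀,N₁,N₂) = s4Kernels.stabilizeIter m`,
`H = Stab N₀ ∩ Stab N₁`, `C = Stab N₂` (in `Aut S`); "`φ ≡ d (mod M)`" is the pointwise congruence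
`∀ s, φ s * (d s)⁻¹ ∈ M`; `M` ranges over the characteristic finite-index subgroups of `S` ("levels").

* `congr_comp_right` — congruences modulo a characteristic `M` compose in the RIGHT factor:
  `ρ ≡ y ∘ d` and `d ≡ x' ∘ c` give `ρ ≡ y ∘ x' ∘ c (mod M)`.
* `isProduct_of_principalRightFamily` — the RIGHT CRITERION: let `c ∈ C`; if at every level `M` the
  product-congruence `ρ ≡ y_M ∘ d_M (mod M)` (`y_M ∈ H`, `d_M ∈ C`) can be achieved with a right factor
  `d_M ≡ x'_M ∘ c (mod M)` (`x'_M ∈ H`), then `ρ = ψ ∘ c` with `ψ := ρ ∘ c⁻¹ ∈ H` — an honest product.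
  (`ψ ≡ y_M ∘ x'_M ∈ H (mod M)` at every level and `N₀`, `N₁` are closed, `closed_stabilizeIter m 0/1`, so
  `map_eq_of_congr_of_closed` gives `ψ(N₀) = N₀`, `ψ(N₁) = N₁`.)
* `stub_isProductOfPrincipalRightFamily` — the registered signature, verbatim.
* Riders: `isProduct_of_frozenRight` (a frozen right factor gives an honest product — strengthens
  `tripleJoin_eq_top_of_frozenRight`, which only gave `N₀ ⊔ N₁ ⊔ ρN₂ = ⊤`), also in the registered-signature
  style `isProduct_of_frozenRight'`; and the converse `principalRightFamily_of_isProduct` (an honest product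
  `x ∘ c` has only principal right-factor families: every admissible right factor `d` at a characteristic level
  `M`, `ρ ≡ y ∘ d (mod M)` with `y ∈ H`, is `≡ x' ∘ c (mod M)` with `x' := y⁻¹ ∘ x ∈ H`), also primed.
-/

noncomputable section

-- the prescribed namespace `Summit.<P>.<Sub>.…` duplicates `SmoothPoincare4` (P = Sub)
set_option linter.dupNamespace false

namespace Summit.SmoothPoincare4.SmoothPoincare4.Theorems.HeegaardHandlebodyCongruenceClosed.PairRigidityRetraction

open Literature.Topology.FourManifolds Subgroup

/-! ## Congruence calculus: composition in the right factor -/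

/-- Congruences modulo a characteristic `M` compose in the right factor: `ρ ≡ y ∘ d` and `d ≡ x' ∘ c` (mod `M`)
give `ρ ≡ y ∘ x' ∘ c (mod M)` (apply `y` to the second congruence, then multiply). [folklore] -/
theorem congr_comp_right {G : Type*} [Group G] {ρ y d x' c : G ≃* G} {M : Subgroup G} (hM : M.Characteristic)
    (h₁ : ∀ s, ρ s * (y (d s))⁻¹ ∈ M) (h₂ : ∀ s, d s * (x' (c s))⁻¹ ∈ M) :
    ∀ s, ρ s * (y (x' (c s)))⁻¹ ∈ M := fun s => by
  have h₃ : y (d s) * (y (x' (c s)))⁻¹ ∈ M := by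
    simpa [map_mul, map_inv] using apply_mem_of_characteristic hM y (h₂ s)
  have : ρ s * (y (x' (c s)))⁻¹ = (ρ s * (y (d s))⁻¹) * (y (d s) * (y (x' (c s)))⁻¹) := by group
  rw [this]
  exact mul_mem (h₁ s) h₃

/-! ## The right criterion -/

/-- **Right criterion (principal right-factor families are products).** Let `c ∈ C = Stab N₂`.  Suppose that at
every characteristic finite-index level `M` there are `y, x' ∈ H = Stab N₀ ∩ Stab N₁` and `d ∈ C` with
`ρ ≡ y ∘ d (mod M)` and `d ≡ x' ∘ c (mod M)`.  Then `ρ = ψ ∘ c` on the nose with `ψ := ρ ∘ c⁻¹ ∈ H`: indeed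
`ψ ≡ y ∘ x' ∈ H (mod M)` at every level, so `ψ(N₀) = N₀` and `ψ(N₁) = N₁` because `N₀`, `N₁` are closed
(`closed_stabilizeIter m 0`, `closed_stabilizeIter m 1`). [folklore] -/
theorem isProduct_of_principalRightFamily {m : ℕ} {ρ : SurfaceGroup (3 + 3 * m) ≃* SurfaceGroup (3 + 3 * m)}
    (c : SurfaceGroup (3 + 3 * m) ≃* SurfaceGroup (3 + 3 * m))
    (hc : (s4Kernels.stabilizeIter m 2).map c.toMonoidHom = s4Kernels.stabilizeIter m 2)
    (h : ∀ M : Subgroup (SurfaceGroup (3 + 3 * m)), M.Characteristic → M.FiniteIndex →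
      ∃ y d x' : SurfaceGroup (3 + 3 * m) ≃* SurfaceGroup (3 + 3 * m),
        (s4Kernels.stabilizeIter m 0).map y.toMonoidHom = s4Kernels.stabilizeIter m 0 ∧
        (s4Kernels.stabilizeIter m 1).map y.toMonoidHom = s4Kernels.stabilizeIter m 1 ∧
        (s4Kernels.stabilizeIter m 2).map d.toMonoidHom = s4Kernels.stabilizeIter m 2 ∧
        (s4Kernels.stabilizeIter m 0).map x'.toMonoidHom = s4Kernels.stabilizeIter m 0 ∧
        (s4Kernels.stabilizeIter m 1).map x'.toMonoidHom = s4Kernels.stabilizeIter m 1 ∧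
        (∀ s, ρ s * (y (d s))⁻¹ ∈ M) ∧ ∀ s, d s * (x' (c s))⁻¹ ∈ M) :
    ∃ x c : SurfaceGroup (3 + 3 * m) ≃* SurfaceGroup (3 + 3 * m),
      (s4Kernels.stabilizeIter m 0).map x.toMonoidHom = s4Kernels.stabilizeIter m 0 ∧
      (s4Kernels.stabilizeIter m 1).map x.toMonoidHom = s4Kernels.stabilizeIter m 1 ∧
      (s4Kernels.stabilizeIter m 2).map c.toMonoidHom = s4Kernels.stabilizeIter m 2 ∧
      ∀ s, ρ s = x (c s) := by
  refine ⟨c.symm.trans ρ, c, ?_, ?_, hc, fun s => by simp⟩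
  · refine map_eq_of_congr_of_closed (closed_stabilizeIter m 0) fun M hM hF => ?_
    obtain ⟨y, d, x', hy0, -, -, hx'0, -, h₁, h₂⟩ := h M hM hF
    refine ⟨x'.trans y, map_trans_eq_of_map_eq hx'0 hy0, fun s => ?_⟩
    show ρ (c.symm s) * (y (x' s))⁻¹ ∈ M
    simpa using congr_comp_right hM h₁ h₂ (c.symm s)
  · refine map_eq_of_congr_of_closed (closed_stabilizeIter m 1) fun M hM hF => ?_
    obtain ⟨y, d, x', -, hy1, -, -, hx'1, h₁, h₂⟩ := h M hM hF
    refine ⟨x'.trans y, map_trans_eq_of_map_eq hx'1 hy1, fun s => ?_⟩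
    show ρ (c.symm s) * (y (x' s))⁻¹ ∈ M
    simpa using congr_comp_right hM h₁ h₂ (c.symm s)

/-- **Registered stub `stub_isProductOfPrincipalRightFamily` of line `pair-rigidity-retraction`** (signature verbatim
as registered on stmt-SmoothPoincare4-14596): the right criterion `= isProduct_of_principalRightFamily`. [folklore] -/
theorem stub_isProductOfPrincipalRightFamily : ∀ (m : ℕ) (ρ c : Literature.Topology.FourManifolds.SurfaceGroup (3 + 3 * m) ≃* Literature.Topology.FourManifolds.SurfaceGroup (3 + 3 * m)), (Literature.Topology.FourManifolds.s4Kernels.stabilizeIter m 2).map c.toMonoidHom = Literature.Topology.FourManifolds.s4Kernels.stabilizeIter m 2 → (∀ M : Subgroup (Literature.Topology.FourManifolds.SurfaceGroup (3 + 3 * m)), M.Characteristic → M.FiniteIndex → ∃ y d x' : Literature.Topology.FourManifolds.SurfaceGroup (3 + 3 * m) ≃* Literature.Topology.FourManifolds.SurfaceGroup (3 + 3 * m), (Literature.Topology.FourManifolds.s4Kernels.stabilizeIter m 0).map y.toMonoidHom = Literature.Topology.FourManifolds.s4Kernels.stabilizeIter m 0 ∧ (Literature.Topology.FourManifolds.s4Kernels.stabilizeIter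 m 1).map y.toMonoidHom = Literature.Topology.FourManifolds.s4Kernels.stabilizeIter m 1 ∧ (Literature.Topology.FourManifolds.s4Kernels.stabilizeIter m 2).map d.toMonoidHom = Literature.Topology.FourManifolds.s4Kernels.stabilizeIter m 2 ∧ (Literature.Topology.FourManifolds.s4Kernels.stabilizeIter m 0).map x'.toMonoidHom = Literature.Topology.FourManifolds.s4Kernels.stabilizeIter m 0 ∧ (Literature.Topology.FourManifolds.s4Kernels.stabilizeIter m 1).map x'.toMonoidHom = Literature.Topology.FourManifolds.s4Kernels.stabilizeIter m 1 ∧ (∀ s, ρ s * (y (d s))⁻¹ ∈ M) ∧ ∀ s, d s * (x' (c s))⁻¹ ∈ M) → ∃ x c : Literature.Topology.FourManifolds.SurfaceGroup (3 + 3 * m) ≃* Literature.Topology.FourManifolds.SurfaceGroup (3 + 3 * m), (Literature.Topology.FourManifolds.s4Kernels.stabilizeIter m 0).map x.toMonoidHom = Literature.Topology.FourManifolds.s4Kernels.stabilizeIter m 0 ∧ (Literature.Topology.FourManifolds.s4Kernels.stabilizeIter m 1).map x.toMonoidHom = Literature.Topology.FourManifolds.s4Kernels.stabilizeIter m 1 ∧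 (Literature.Topology.FourManifolds.s4Kernels.stabilizeIter m 2).map c.toMonoidHom = Literature.Topology.FourManifolds.s4Kernels.stabilizeIter m 2 ∧ ∀ s, ρ s = x (c s) :=
  fun _ _ c hc h => isProduct_of_principalRightFamily c hc h

/-! ## Riders: the frozen right factor; the converse -/

/-- **A frozen right factor gives an honest product.** If ONE `c ∈ C` serves at every characteristic finite-index
level (`ρ ≡ x_M ∘ c (mod M)` with `x_M ∈ H`), then `ρ = x ∘ c'` with `x ∈ H`, `c' ∈ C` (namely `c' = c`,
`x = ρ ∘ c⁻¹`).  The special case `d := c`, `x' := 1` of the right criterion; it strengthens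
`tripleJoin_eq_top_of_frozenRight` (which only concluded `N₀ ⊔ N₁ ⊔ ρN₂ = ⊤`). [folklore] -/
theorem isProduct_of_frozenRight {m : ℕ} {ρ : SurfaceGroup (3 + 3 * m) ≃* SurfaceGroup (3 + 3 * m)}
    (c : SurfaceGroup (3 + 3 * m) ≃* SurfaceGroup (3 + 3 * m))
    (hc : (s4Kernels.stabilizeIter m 2).map c.toMonoidHom = s4Kernels.stabilizeIter m 2)
    (h : ∀ M : Subgroup (SurfaceGroup (3 + 3 * m)), M.Characteristic → M.FiniteIndex →
      ∃ x : SurfaceGroup (3 + 3 * m) ≃* SurfaceGroup (3 + 3 * m),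
        (s4Kernels.stabilizeIter m 0).map x.toMonoidHom = s4Kernels.stabilizeIter m 0 ∧
        (s4Kernels.stabilizeIter m 1).map x.toMonoidHom = s4Kernels.stabilizeIter m 1 ∧
        ∀ s, ρ s * (x (c s))⁻¹ ∈ M) :
    ∃ x c : SurfaceGroup (3 + 3 * m) ≃* SurfaceGroup (3 + 3 * m),
      (s4Kernels.stabilizeIter m 0).map x.toMonoidHom = s4Kernels.stabilizeIter m 0 ∧
      (s4Kernels.stabilizeIter m 1).map x.toMonoidHom = s4Kernels.stabilizeIter m 1 ∧
      (s4Kernels.stabilizeIter m 2).map c.toMonoidHom = s4Kernels.stabilizeIter m 2 ∧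
      ∀ s, ρ s = x (c s) := by
  refine isProduct_of_principalRightFamily c hc fun M hM hF => ?_
  obtain ⟨x, hx0, hx1, hs⟩ := h M hM hF
  refine ⟨x, c, MulEquiv.refl _, hx0, hx1, hc, ?_, ?_, hs, fun s => ?_⟩
  · ext s
    simp
  · ext s
    simp
  · simp [one_mem]

/-- The frozen-right rider in the registered-signature style, `= isProduct_of_frozenRight`. [folklore] -/
theorem isProduct_of_frozenRight' :
    ∀ (m : ℕ) (ρ c : Literature.Topology.FourManifolds.SurfaceGroup (3 + 3 * m) ≃*
        Literature.Topology.FourManifolds.SurfaceGroup (3 + 3 * m)),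
      (Literature.Topology.FourManifolds.s4Kernels.stabilizeIter m 2).map c.toMonoidHom =
        Literature.Topology.FourManifolds.s4Kernels.stabilizeIter m 2 →
      (∀ M : Subgroup (Literature.Topology.FourManifolds.SurfaceGroup (3 + 3 * m)), M.Characteristic →
        M.FiniteIndex →
        ∃ x : Literature.Topology.FourManifolds.SurfaceGroup (3 + 3 * m) ≃*
            Literature.Topology.FourManifolds.SurfaceGroup (3 + 3 * m),
          (Literature.Topology.FourManifolds.s4Kernels.stabilizeIter m 0).map x.toMonoidHom =
            Literature.Topology.FourManifolds.s4Kernels.stabilizeIter m 0 ∧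
          (Literature.Topology.FourManifolds.s4Kernels.stabilizeIter m 1).map x.toMonoidHom =
            Literature.Topology.FourManifolds.s4Kernels.stabilizeIter m 1 ∧
          ∀ s, ρ s * (x (c s))⁻¹ ∈ M) →
      ∃ x c : Literature.Topology.FourManifolds.SurfaceGroup (3 + 3 * m) ≃*
          Literature.Topology.FourManifolds.SurfaceGroup (3 + 3 * m),
        (Literature.Topology.FourManifolds.s4Kernels.stabilizeIter m 0).map x.toMonoidHom =
          Literature.Topology.FourManifolds.s4Kernels.stabilizeIter m 0 ∧
        (Literature.Topology.FourManifolds.s4Kernels.stabilizeIter m 1).map x.toMonoidHom =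
          Literature.Topology.FourManifolds.s4Kernels.stabilizeIter m 1 ∧
        (Literature.Topology.FourManifolds.s4Kernels.stabilizeIter m 2).map c.toMonoidHom =
          Literature.Topology.FourManifolds.s4Kernels.stabilizeIter m 2 ∧
        ∀ s, ρ s = x (c s) :=
  fun _ _ c hc h => isProduct_of_frozenRight c hc h

/-- **Conversely, an honest product has only principal right-factor families.** If `ρ = x ∘ c` with `x ∈ H`, then
for every characteristic `M` and every admissible pair `(y, d)` at `M` (`y ∈ H`, `ρ ≡ y ∘ d (mod M)`) the right
factor `d` is `≡ x' ∘ c (mod M)` for some `x' ∈ H`, namely `x' := y⁻¹ ∘ x` (divide the congruence `x c ≡ y d` on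
the left by `y` and invert).  Neither `c, d ∈ C` nor finite index of `M` is needed. [folklore] -/
theorem principalRightFamily_of_isProduct {m : ℕ} {ρ : SurfaceGroup (3 + 3 * m) ≃* SurfaceGroup (3 + 3 * m)}
    (x c : SurfaceGroup (3 + 3 * m) ≃* SurfaceGroup (3 + 3 * m))
    (hx0 : (s4Kernels.stabilizeIter m 0).map x.toMonoidHom = s4Kernels.stabilizeIter m 0)
    (hx1 : (s4Kernels.stabilizeIter m 1).map x.toMonoidHom = s4Kernels.stabilizeIter m 1)
    (hρ : ∀ s, ρ s = x (c s)) {M : Subgroup (SurfaceGroup (3 + 3 * m))} (hM : M.Characteristic)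
    (y d : SurfaceGroup (3 + 3 * m) ≃* SurfaceGroup (3 + 3 * m))
    (hy0 : (s4Kernels.stabilizeIter m 0).map y.toMonoidHom = s4Kernels.stabilizeIter m 0)
    (hy1 : (s4Kernels.stabilizeIter m 1).map y.toMonoidHom = s4Kernels.stabilizeIter m 1)
    (h : ∀ s, ρ s * (y (d s))⁻¹ ∈ M) :
    ∃ x' : SurfaceGroup (3 + 3 * m) ≃* SurfaceGroup (3 + 3 * m),
      (s4Kernels.stabilizeIter m 0).map x'.toMonoidHom = s4Kernels.stabilizeIter m 0 ∧
      (s4Kernels.stabilizeIter m 1).map x'.toMonoidHom = s4Kernels.stabilizeIter m 1 ∧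
      ∀ s, d s * (x' (c s))⁻¹ ∈ M := by
  refine ⟨x.trans y.symm, map_trans_eq_of_map_eq hx0 (map_symm_eq_of_map_eq y hy0),
    map_trans_eq_of_map_eq hx1 (map_symm_eq_of_map_eq y hy1), fun s => ?_⟩
  -- `x (c s) ≡ y (d s)`, divide by `y` on the left: `y⁻¹ (x (c s)) ≡ d s`, then invert
  have h₁ : x (c s) * (y (d s))⁻¹ ∈ M := by simpa [hρ] using h s
  have h₂ : y.symm (x (c s)) * (d s)⁻¹ ∈ M := symm_apply_mul_inv_mem hM y h₁
  show d s * (y.symm (x (c s)))⁻¹ ∈ M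
  simpa [mul_inv_rev] using inv_mem h₂

/-- The converse in the registered-signature style (`∀ m ρ x c, x ∈ H → c ∈ C → ρ = x ∘ c → ∀ M` level `→ ∀ y d`
admissible at `M` with `y ∈ H`, `∃ x' ∈ H, d ≡ x' ∘ c (mod M)`), `= principalRightFamily_of_isProduct`.
[folklore] -/
theorem principalRightFamily_of_isProduct' :
    ∀ (m : ℕ) (ρ x c : Literature.Topology.FourManifolds.SurfaceGroup (3 + 3 * m) ≃*
        Literature.Topology.FourManifolds.SurfaceGroup (3 + 3 * m)),
      (Literature.Topology.FourManifolds.s4Kernels.stabilizeIter m 0).map x.toMonoidHom =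
        Literature.Topology.FourManifolds.s4Kernels.stabilizeIter m 0 →
      (Literature.Topology.FourManifolds.s4Kernels.stabilizeIter m 1).map x.toMonoidHom =
        Literature.Topology.FourManifolds.s4Kernels.stabilizeIter m 1 →
      (Literature.Topology.FourManifolds.s4Kernels.stabilizeIter m 2).map c.toMonoidHom =
        Literature.Topology.FourManifolds.s4Kernels.stabilizeIter m 2 →
      (∀ s, ρ s = x (c s)) →
      ∀ M : Subgroup (Literature.Topology.FourManifolds.SurfaceGroup (3 + 3 * m)), M.Characteristic →
        M.FiniteIndex →
      ∀ y d : Literature.Topology.FourManifolds.SurfaceGroup (3 + 3 * m) ≃*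
          Literature.Topology.FourManifolds.SurfaceGroup (3 + 3 * m),
        (Literature.Topology.FourManifolds.s4Kernels.stabilizeIter m 0).map y.toMonoidHom =
          Literature.Topology.FourManifolds.s4Kernels.stabilizeIter m 0 →
        (Literature.Topology.FourManifolds.s4Kernels.stabilizeIter m 1).map y.toMonoidHom =
          Literature.Topology.FourManifolds.s4Kernels.stabilizeIter m 1 →
        (∀ s, ρ s * (y (d s))⁻¹ ∈ M) →
        ∃ x' : Literature.Topology.FourManifolds.SurfaceGroup (3 + 3 * m) ≃*
            Literature.Topology.FourManifolds.SurfaceGroup (3 + 3 * m),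
          (Literature.Topology.FourManifolds.s4Kernels.stabilizeIter m 0).map x'.toMonoidHom =
            Literature.Topology.FourManifolds.s4Kernels.stabilizeIter m 0 ∧
          (Literature.Topology.FourManifolds.s4Kernels.stabilizeIter m 1).map x'.toMonoidHom =
            Literature.Topology.FourManifolds.s4Kernels.stabilizeIter m 1 ∧
          ∀ s, d s * (x' (c s))⁻¹ ∈ M :=
  fun _ _ x c hx0 hx1 _ hρ _ hM _ y d hy0 hy1 h =>
    principalRightFamily_of_isProduct x c hx0 hx1 hρ hM y d hy0 hy1 h

end Summit.SmoothPoincare4.SmoothPoincare4.Theorems.HeegaardHandlebodyCongruenceClosed.PairRigidityRetraction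

end
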